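import Mathlib
import Summits.Ventures.PercRepro2.HubBernstein

/-!
# Uniqueness of degree-3 tensor-Bernstein coefficients (blind cell PercRepro2, mine-2 g22)

`Hub.bern q k = ∏ᵢ qᵢ^{kᵢ} (1 − qᵢ)^{3 − kᵢ}` (no binomial factors).  Two coefficient functions
`a, b : (ι → Fin 4) → R` with `Σ_k bern q k · a k = Σ_k bern q k · b k` on the grid `{0, 1/3, 2/3, 1}^ι`
coincide: the one-edge collocation matrix `bm i j = (i/3)^j (1 − i/3)^{3 − j}` is invertible (its inverse
`nm`, with `Σᵢ nm j i · bm i j' = δ_{j j'}`, `nm_bm`), and the tensor product of invertible matrices is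
invertible — `coeff_eq_sum_grid` reads every coefficient off the grid values (`Finset.prod_univ_sum`), hence
**`bern_coeff_unique`**.  Used for the per-profile (typed) shadow of the pendant dictionary.
-/

namespace Summit.Ventures.PercRepro2.Hub

section Grid

variable {R : Type*} [Field R] [CharZero R]

/-- The grid `0, 1/3, 2/3, 1`. -/
def grid (i : Fin 4) : R := (i : ℕ) / 3

/-- The one-edge collocation matrix: the basis function `j` at the grid point `i`. -/
def bm (i j : Fin 4) : R := grid i ^ (j : ℕ) * (1 - grid i) ^ (3 - (j : ℕ))

/-- Its inverse. -/
def nm (j i : Fin 4) : R :=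
  !![(1 : R), 0, 0, 0; -5 / 2, 9, -9 / 2, 1; 1, -9 / 2, 9, -5 / 2; 0, 0, 0, 1] j i

/-- `nm` inverts `bm`. -/
lemma nm_bm (j j' : Fin 4) : ∑ i, nm j i * bm i j' = if j = j' then (1 : R) else 0 := by
  fin_cases j <;> fin_cases j' <;>
    simp [nm, bm, grid, Fin.sum_univ_four, Matrix.of_apply, Matrix.cons_val] <;> norm_num

end Grid

section Unique

variable {ι : Type*} [Fintype ι] [DecidableEq ι] {R : Type*} [Field R] [CharZero R]

omit [DecidableEq ι] [CharZero R] in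
/-- `bern` at a grid point is the product of the collocation entries. -/
lemma bern_grid (i : ι → Fin 4) (k : ι → Fin 4) :
    bern (fun e => (grid (i e) : R)) k = ∏ e, bm (i e) (k e) := by
  unfold bern bm
  rfl

/-- **Inverse collocation**: every coefficient is a fixed linear combination of the grid values. -/
theorem coeff_eq_sum_grid (a : (ι → Fin 4) → R) (k : ι → Fin 4) :
    a k = ∑ i : ι → Fin 4, (∏ e, nm (k e) (i e)) *
      ∑ k' : ι → Fin 4, bern (fun e => (grid (i e) : R)) k' * a k' := by
  simp only [bern_grid, Finset.mul_sum]
  rw [Finset.sum_comm]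
  have h : ∀ k' : ι → Fin 4, ∑ i : ι → Fin 4, (∏ e, nm (k e) (i e)) * ((∏ e, bm (i e) (k' e)) * a k') =
      (∏ e, if k e = k' e then (1 : R) else 0) * a k' := by
    intro k'
    have e1 : ∀ i : ι → Fin 4, (∏ e, nm (k e) (i e)) * ((∏ e, bm (i e) (k' e)) * a k') =
        (∏ e, nm (k e) (i e) * bm (i e) (k' e)) * a k' := by
      intro i; rw [Finset.prod_mul_distrib]; ring
    simp only [e1, ← Finset.sum_mul]
    congr 1
    symm
    calc ∏ e, (if k e = k' e then (1 : R) else 0) = ∏ e, ∑ j, nm (k e) j * bm j (k' e) := by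
          simp only [nm_bm]
      _ = ∑ x ∈ Fintype.piFinset (fun _ : ι => (Finset.univ : Finset (Fin 4))),
            ∏ e, nm (k e) (x e) * bm (x e) (k' e) := Finset.prod_univ_sum _ _
      _ = ∑ x : ι → Fin 4, ∏ e, nm (k e) (x e) * bm (x e) (k' e) := by
          rw [Fintype.piFinset_univ]
  simp only [h]
  rw [Finset.sum_eq_single k]
  · simp
  · intro k' _ hne
    have : ∃ e, k e ≠ k' e := by
      by_contra hall
      exact hne (funext fun e => by_contra fun h => hall ⟨e, fun h' => h h'.symm⟩)
    obtain ⟨e, he⟩ := this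
    rw [Finset.prod_eq_zero (Finset.mem_univ e) (by simp [he]), zero_mul]
  · intro h; exact absurd (Finset.mem_univ k) h

/-- **Uniqueness of the tensor-Bernstein coefficients** on the grid `{0, 1/3, 2/3, 1}^ι`. -/
theorem bern_coeff_unique {a b : (ι → Fin 4) → R}
    (h : ∀ i : ι → Fin 4, ∑ k, bern (fun e => (grid (i e) : R)) k * a k =
      ∑ k, bern (fun e => (grid (i e) : R)) k * b k) : a = b := by
  funext k
  rw [coeff_eq_sum_grid a k, coeff_eq_sum_grid b k]
  simp only [h]

end Unique

end Summit.Ventures.PercRepro2.Hub
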